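import Summits.QuantumFields.BalabanUV.Beta.D1BFx.KernelFormOperators

/-!
# `BalabanUV.Beta.D1BFx.HodgeIdentityForms` — road «BF-x» for binder row D1, slot (K), X₁ brick Q2 «LOCAL STENCIL DICTIONARY an5 ↔ an2», FILE 1 (an2 side):
# THE LATTICE HODGE IDENTITY ON 1-FORMS IN `AffineAveraging` CURRENCY — `½·curvAdj∘curv + dz∘codiff₁ = codiff₁∘dz` COMPONENTWISE (= pv23's `lapKer` on each component)

WHY (road «BF-x», owner `b2b-balaban-beta-d1-p2`; `HOME/b2b-balaban-beta-d1-p2/X1-SPEC.md` v1 §0 audit-trail item «½» and §1 brick Q2; journal SHAPE CORRECTION «hX1a»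
2026-08-20T18:40Z, RULING ρ-g5-5).  The one analytic upstream (X₁a) of slot (K)'s kernel dictionary reads an2's Euler–Lagrange stencil `curvAdj (curv A)` (the
formal gradient of `½ Σ|curv A|²`, where `curv` runs over ALL ORDERED direction pairs) against the vector part `Lap = Σ_ν (fdiff ν)ᴴ fdiff ν` of an5's torus operator
`B5DeltaA169.DeltaA`.  The exchange rate between the two currencies is the flat-lattice Hodge∕Weitzenböck identity proved here: for every lattice 1-form `A` on `ℤ^d`
with values in any commutative ring,
  `curvAdj (curv A) μ y + 2 • dz (codiff₁ A) μ y = 2 • codiff₁ (dz (A μ)) y`      (`curvAdj∘curv = 2·d*d`, `dz∘codiff₁ = d d*`),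
i.e. `½·curvAdj∘curv + dz∘codiff₁` IS the positive nearest-neighbour Laplacian `codiff₁∘dz = −Δ` acting on EACH COMPONENT `A μ` SEPARATELY (fibre-diagonal): the
ratio curl–curl : gradient-of-divergence is `1 : 2`, NOT `1 : 1` (the owner's exact check on `(ℤ∕4)²`, `(ℤ∕3)³`, `HOME/b2b-balaban-beta-d1-p2/toy/check_normalisation.py`,
becomes §1; §4 pins both coefficients in the kernel by two `decide` witnesses).  Consequence for Q2: the `Lap` comparison is with the SCALAR Laplacian kernel
`lapKer ⊗ δ_{κl}`; the only fibre-mixing ∕ non-local piece of the (X₁a) operator is the projector word `dz∘Pf∘codiff₁` (bricks Q3).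

WHAT THIS FILE PROVES (all [folklore]; §1–§2 for `Form1 d R`, ANY `d`, ANY `CommRing R` (§2's halved forms over a field with `2 ≠ 0` ∕ over `ℝ`); §3 at `d = 4` over `ℝ`):
* §1 `summand_identity` (the per-direction cancellation) · **`curvAdj_curv_add_two_nsmul_dz_codiff₁`** (displayed identity, pointwise) · `curvAdj_curv_apply` (solved for the
  Euler–Lagrange stencil) · `curvAdj_curv_eq` (function level) · `curvAdj_curv_apply_of_dz_codiff₁_eq_zero` ∕ `curvAdj_curv_apply_of_codiff₁_const` (co-closed ∕
  constant-divergence forms: `curvAdj∘curv = 2·codiff₁∘dz` componentwise) · `dz_codiff₁_dz_comm` (the scalar Laplacian commutes with the gradient, any ring).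
* §2 `half_curvAdj_curv_add_dz_codiff₁` (`(2:𝕜)⁻¹·curvAdj (curv A) μ y + dz (codiff₁ A) μ y = codiff₁ (dz (A μ)) y`, field `𝕜`, `2 ≠ 0`) · `…_real` (`(1∕2 : ℝ)·…`).
* §3 road currency (`d = 4`, `ℝ`): **`half_curvAdj_curv_add_dz_codiff₁_eq_tsum_lapKer`** — `(1∕2)·curvAdj (curv A) μ y + dz (codiff₁ A) μ y = Σ'_r lapKer y r · A μ r` (pv23's
  positive Laplacian KERNEL on the component, via `TowerEquationForms.codiff₁_dz_eq_tsum_lapKer`); `dz_Rf_apply` + **`half_curvAdj_curv_add_dz_Rf_codiff₁`** ∕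
  `…_eq_tsum_lapKer_sub` — the same with the Landau-type split `Rf n a = id − Pf n a` of `KernelFormOperators` (B4) in the gauge term:
  `(1∕2)·curvAdj (curv A) μ y + dz (Rf n a (codiff₁ A)) μ y = codiff₁ (dz (A μ)) y − dz (Pf n a (codiff₁ A)) μ y` (pure rearrangement, NO summability needed).
* §4 kernel witnesses over `ℤ`, `d = 2` (`decide`): at an2's `quadForm` (`A₀ = x₁²`) the triple (`curvAdj∘curv`, `dz∘codiff₁`, `codiff₁∘dz` on the component) at
  `(μ, y) = (0, 0)` is `(−4, 0, −2)` (`witness_quadForm`); at the exact form `A₀ = x₀²`, `A₁ = 0` (written inline) it is `(0, −2, −2)` (`witness_sqForm`) — so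
  `(½, 1)` is the ONLY pair of rational coefficients `(a, b)` with `a·curvAdj∘curv + b·dz∘codiff₁ = codiff₁∘dz` at both (`witness_coefficients_unique`).

HONEST FRAMING (cell contract, verbatim): «discharging `BetaPertH` makes Bałaban's UV stability UNCONDITIONAL — a real constructive-QFT result; it is NOT the continuum
limit and NOT the Clay problem.»  HONEST DEPENDENCY (verbatim): «continuum YM on T⁴ ⇐ BetaPertH ∧ nine spine estimates (0/9 proved); BetaPertH ⇐ (D1) ∧ (D4) ∧ CAP+tail;
G-an2-4 gates asym, D1 and NE2/3/4.»  [folklore] finite-difference algebra on an2's typed operators; NO definition (the second witness form is written inline); no `Prop` is minted, nothing is cited, no wall binder is instantiated; (X₁a) is NOT touched (Q4 assembles); 0 sorry.  NOT summit progress, NOT D1, NOT BetaPertH.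
ABSOLUTE RULE (cell, verbatim): «No internally-minted statement may enter as a cited fact. Every hypothesis is either kernel-proved in this package or a verbatim quotation
of a PUBLISHED theorem with page reference. The manuscript(s) under audit are NOT citable for their own disputed steps — they are the thing under adjudication;
programme-internal (2001/route/tribunal) claims are never citable.»
Provenance: G-an2-4 swarm leaf seat `b2b-balaban-gan24-formalise-leaf-06` gen 28 (prover-b2b-balaban-gan24-formalise-leaf-06-g28-0; cross-lane idle-seat duty G-an2-4 → D1,
road «BF-x», CLAIM «X1-Q2» journal l.19491), 2026-08-20.
-/

namespace Summit.QuantumFields.BalabanUV.Beta.D1BFx.HodgeIdentityForms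

open Literature.MathematicalPhysics.QuantumFieldTheory.Balaban1983to89
open Literature.MathematicalPhysics.QuantumFieldTheory.Balaban1983to89.Beta
open AffineAveraging (Site Form0 Form1 Form2 unitVec dz curv curvAdj codiff₁ quadForm)
open B6QGQLower276 (lapKer)
open TowerEquationForms (codiff₁_dz_eq_tsum_lapKer)
open KernelFormOperators (Pf Rf)

/-! ## §1 The identity (any dimension, any commutative ring) -/

section General

variable {d : ℕ} {R : Type*} [CommRing R]

/-- [folklore] The per-direction cancellation behind the Hodge identity: for fixed `μ`, `l`, the `l`-th summands of `curvAdj (curv A) μ y` (both sums of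
`AffineAveraging.curvAdj`) plus twice the `l`-th summand of `dz (codiff₁ A) μ y` equal twice the `l`-th summand of `codiff₁ (dz (A μ)) y`; every mixed term
`A l (y + e_μ)`, `A l y`, `A l (y + e_μ − e_l)`, `A l (y − e_l)` cancels. -/
theorem summand_identity (A : Form1 d R) (μ l : Fin d) (y : Site d) :
    (curv A μ l y - curv A μ l (y - unitVec l)) + (curv A l μ (y - unitVec l) - curv A l μ y)
      + 2 • ((A l (y + unitVec μ - unitVec l) - A l (y + unitVec μ)) - (A l (y - unitVec l) - A l y))
      = 2 • (dz (A μ) l (y - unitVec l) - dz (A μ) l y) := by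
  simp only [curv, dz, sub_add_cancel, sub_add_eq_add_sub]
  abel

/-- [folklore] **THE LATTICE HODGE IDENTITY ON 1-FORMS, an2's normalisation**: for every 1-form `A` on `ℤ^d` (values in any commutative ring), every direction `μ`
and site `y`, `curvAdj (curv A) μ y + 2 • dz (codiff₁ A) μ y = 2 • codiff₁ (dz (A μ)) y` — the Euler–Lagrange stencil of `½ Σ|curv A|²` (`curv` on ALL ordered pairs,
so `curvAdj∘curv = 2·d*d`) plus TWICE the gradient of the divergence term is twice the positive scalar Laplacian `codiff₁∘dz = −Δ` of the component `A μ`. -/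
theorem curvAdj_curv_add_two_nsmul_dz_codiff₁ (A : Form1 d R) (μ : Fin d) (y : Site d) :
    curvAdj (curv A) μ y + 2 • dz (codiff₁ A) μ y = 2 • codiff₁ (dz (A μ)) y := by
  show ((∑ l, (curv A μ l y - curv A μ l (y - unitVec l))) + ∑ κ, (curv A κ μ (y - unitVec κ) - curv A κ μ y))
      + 2 • ((∑ κ, (A κ (y + unitVec μ - unitVec κ) - A κ (y + unitVec μ))) - ∑ κ, (A κ (y - unitVec κ) - A κ y))
      = 2 • ∑ κ, (dz (A μ) κ (y - unitVec κ) - dz (A μ) κ y)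
  rw [← Finset.sum_sub_distrib, ← Finset.sum_add_distrib, Finset.smul_sum, Finset.smul_sum, ← Finset.sum_add_distrib]
  exact Finset.sum_congr rfl fun l _ => summand_identity A μ l y

/-- [folklore] The Hodge identity solved for the Euler–Lagrange stencil: `curvAdj (curv A) μ y = 2 • codiff₁ (dz (A μ)) y − 2 • dz (codiff₁ A) μ y`. -/
theorem curvAdj_curv_apply (A : Form1 d R) (μ : Fin d) (y : Site d) :
    curvAdj (curv A) μ y = 2 • codiff₁ (dz (A μ)) y - 2 • dz (codiff₁ A) μ y := by
  rw [← curvAdj_curv_add_two_nsmul_dz_codiff₁ A μ y, add_sub_cancel_right]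

/-- [folklore] Function-level form: `curvAdj (curv A) = (μ, y ↦ 2 • codiff₁ (dz (A μ)) y) − 2 • dz (codiff₁ A)`. -/
theorem curvAdj_curv_eq (A : Form1 d R) :
    curvAdj (curv A) = (fun μ y => 2 • codiff₁ (dz (A μ)) y) - 2 • dz (codiff₁ A) := by
  funext μ y
  rw [Pi.sub_apply, Pi.sub_apply, Pi.smul_apply, Pi.smul_apply]
  exact curvAdj_curv_apply A μ y

/-- [folklore] CO-CLOSED ∕ COULOMB-GAUGE case: where the gradient of the divergence vanishes, the Euler–Lagrange stencil IS twice the componentwise positive Laplacian. -/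
theorem curvAdj_curv_apply_of_dz_codiff₁_eq_zero (A : Form1 d R) (μ : Fin d) (y : Site d) (h : dz (codiff₁ A) μ y = 0) :
    curvAdj (curv A) μ y = 2 • codiff₁ (dz (A μ)) y := by
  rw [curvAdj_curv_apply, h, smul_zero, sub_zero]

/-- [folklore] CONSTANT-DIVERGENCE case (e.g. an2's affine 1-forms, `AffineAveraging.codiff₁_affine`): if `codiff₁ A` is constant then
`curvAdj (curv A) μ y = 2 • codiff₁ (dz (A μ)) y` everywhere. -/
theorem curvAdj_curv_apply_of_codiff₁_const (A : Form1 d R) (c : R) (hc : ∀ x, codiff₁ A x = c) (μ : Fin d) (y : Site d) :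
    curvAdj (curv A) μ y = 2 • codiff₁ (dz (A μ)) y :=
  curvAdj_curv_apply_of_dz_codiff₁_eq_zero A μ y (by rw [dz, hc, hc, sub_self])

/-- [folklore] THE SCALAR LAPLACIAN COMMUTES WITH THE GRADIENT (any ring, no halving): `dz (codiff₁ (dz f)) μ y = codiff₁ (dz (dz f μ)) y` — the `μ`-component of the
gradient of `−Δf` is `−Δ` of the `μ`-component of the gradient.  (Consistent with §1 at the curvature-free form `A = dz f`, `AffineAveraging.curv_dz`.) -/
theorem dz_codiff₁_dz_comm (f : Form0 d R) (μ : Fin d) (y : Site d) :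
    dz (codiff₁ (dz f)) μ y = codiff₁ (dz (dz f μ)) y := by
  show (∑ κ, (dz f κ (y + unitVec μ - unitVec κ) - dz f κ (y + unitVec μ))) - ∑ κ, (dz f κ (y - unitVec κ) - dz f κ y)
      = ∑ κ, (dz (dz f μ) κ (y - unitVec κ) - dz (dz f μ) κ y)
  rw [← Finset.sum_sub_distrib]
  refine Finset.sum_congr rfl fun κ _ => ?_
  simp only [dz, sub_add_cancel, sub_add_eq_add_sub]
  rw [add_right_comm y (unitVec κ) (unitVec μ)]
  abel

end General

/-! ## §2 Halved forms (field with `2 ≠ 0`; the road's `ℝ`) -/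

section Halved

variable {d : ℕ}

/-- [folklore] The Hodge identity with the `½` on the curl–curl term, over any field in which `2 ≠ 0`:
`(2:𝕜)⁻¹·curvAdj (curv A) μ y + dz (codiff₁ A) μ y = codiff₁ (dz (A μ)) y`. -/
theorem half_curvAdj_curv_add_dz_codiff₁ {𝕜 : Type*} [Field 𝕜] (h2 : (2 : 𝕜) ≠ 0) (A : Form1 d 𝕜) (μ : Fin d) (y : Site d) :
    (2 : 𝕜)⁻¹ * curvAdj (curv A) μ y + dz (codiff₁ A) μ y = codiff₁ (dz (A μ)) y := by
  have h := curvAdj_curv_add_two_nsmul_dz_codiff₁ A μ y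
  rw [two_nsmul, two_nsmul] at h
  field_simp
  linear_combination h

/-- [folklore] The Hodge identity over `ℝ` in the displayed X₁-SPEC §0 normalisation: `(1∕2)·curvAdj (curv A) μ y + dz (codiff₁ A) μ y = codiff₁ (dz (A μ)) y`. -/
theorem half_curvAdj_curv_add_dz_codiff₁_real (A : Form1 d ℝ) (μ : Fin d) (y : Site d) :
    (1 / 2 : ℝ) * curvAdj (curv A) μ y + dz (codiff₁ A) μ y = codiff₁ (dz (A μ)) y := by
  rw [one_div]
  exact half_curvAdj_curv_add_dz_codiff₁ two_ne_zero A μ y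

end Halved

/-! ## §3 Road currency: `d = 4`, `ℝ`, pv23's `lapKer` and B4's Landau-type split `Rf = id − Pf` -/

section Road

/-- [folklore] **THE LOCAL PART OF THE (X₁a) OPERATOR IS FIBRE-DIAGONAL, = pv23's POSITIVE LAPLACIAN KERNEL ON EACH COMPONENT**:
`(1∕2)·curvAdj (curv A) μ y + dz (codiff₁ A) μ y = Σ'_r lapKer y r · A μ r` for EVERY 1-form `A` on `ℤ⁴` (the `tsum` has finitely many non-zero terms;
`TowerEquationForms.codiff₁_dz_eq_tsum_lapKer`). -/
theorem half_curvAdj_curv_add_dz_codiff₁_eq_tsum_lapKer (A : Form1 4 ℝ) (μ : Fin 4) (y : Site 4) :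
    (1 / 2 : ℝ) * curvAdj (curv A) μ y + dz (codiff₁ A) μ y = ∑' r : Site 4, lapKer y r * A μ r := by
  rw [half_curvAdj_curv_add_dz_codiff₁_real, codiff₁_dz_eq_tsum_lapKer]

/-- [folklore] B4's split in the gauge term, pointwise: `dz (Rf n a g) μ y = dz g μ y − dz (Pf n a g) μ y` (`Rf n a g = g − Pf n a g` definitionally; no summability). -/
theorem dz_Rf_apply (n : ℕ) (a : ℝ) (g : Form0 4 ℝ) (μ : Fin 4) (y : Site 4) :
    dz (Rf n a g) μ y = dz g μ y - dz (Pf n a g) μ y := by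
  simp only [Rf, dz, Pi.sub_apply]
  ring

/-- [folklore] **THE (X₁a)-SHAPED REARRANGEMENT**: with the road's gauge projector split `Rf n a = id − Pf n a` (`KernelFormOperators`),
`(1∕2)·curvAdj (curv A) μ y + dz (Rf n a (codiff₁ A)) μ y = codiff₁ (dz (A μ)) y − dz (Pf n a (codiff₁ A)) μ y` for EVERY 1-form `A` on `ℤ⁴` and every `n`, `a` —
the only non-local ∕ fibre-mixing piece of `½·curvAdj∘curv + dz∘Rf∘codiff₁` is the projector word `dz∘Pf∘codiff₁`.  Pure rearrangement (no convergence used: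
where `Pf`'s series diverges both sides carry the same junk value). -/
theorem half_curvAdj_curv_add_dz_Rf_codiff₁ (n : ℕ) (a : ℝ) (A : Form1 4 ℝ) (μ : Fin 4) (y : Site 4) :
    (1 / 2 : ℝ) * curvAdj (curv A) μ y + dz (Rf n a (codiff₁ A)) μ y
      = codiff₁ (dz (A μ)) y - dz (Pf n a (codiff₁ A)) μ y := by
  rw [dz_Rf_apply, ← add_sub_assoc, half_curvAdj_curv_add_dz_codiff₁_real]

/-- [folklore] The same in KERNEL currency: `(1∕2)·curvAdj (curv A) μ y + dz (Rf n a (codiff₁ A)) μ y = Σ'_r lapKer y r · A μ r − dz (Pf n a (codiff₁ A)) μ y`. -/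
theorem half_curvAdj_curv_add_dz_Rf_codiff₁_eq_tsum_lapKer_sub (n : ℕ) (a : ℝ) (A : Form1 4 ℝ) (μ : Fin 4) (y : Site 4) :
    (1 / 2 : ℝ) * curvAdj (curv A) μ y + dz (Rf n a (codiff₁ A)) μ y
      = (∑' r : Site 4, lapKer y r * A μ r) - dz (Pf n a (codiff₁ A)) μ y := by
  rw [half_curvAdj_curv_add_dz_Rf_codiff₁, codiff₁_dz_eq_tsum_lapKer]

end Road

/-! ## §4 Kernel witnesses (`decide` over `ℤ`, `d = 2`): the coefficient pair `(½, 1)` is pinned -/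

section Witness

/-- [folklore] At an2's `quadForm` (`A₀ = x₁²`, `A₁ = 0`), direction `0`, origin: `curvAdj (curv A) = −4` (an2's `witness_EL_nonzero`), `dz (codiff₁ A) = 0` (the form is
co-closed), `codiff₁ (dz A₀) = −2` — consistent with §1 (`−4 + 2·0 = 2·(−2)`) and INCONSISTENT with the weighting `1 : 1` (`−4 + 0 ≠ −2`). -/
theorem witness_quadForm :
    curvAdj (curv quadForm) 0 0 = -4 ∧ dz (codiff₁ quadForm) 0 0 = 0 ∧ codiff₁ (dz (quadForm 0)) 0 = -2 := by
  decide

/-- [folklore] At the EXACT form `A₀(x) = x₀²`, `A₁ = 0` on `ℤ²` (curvature-free, divergence `1 − 2x₀`; written inline), direction `0`, origin: `curvAdj (curv A) = 0` (exact forms are curvature-free), `dz (codiff₁ A) = −2`,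
`codiff₁ (dz A₀) = −2` — consistent with §1 (`0 + 2·(−2) = 2·(−2)`). -/
theorem witness_sqForm :
    curvAdj (curv (fun κ x => if κ = 0 then x 0 ^ 2 else 0 : Form1 2 ℤ)) 0 0 = 0
      ∧ dz (codiff₁ (fun κ x => if κ = 0 then x 0 ^ 2 else 0 : Form1 2 ℤ)) 0 0 = -2
      ∧ codiff₁ (dz ((fun κ x => if κ = 0 then x 0 ^ 2 else 0 : Form1 2 ℤ) 0)) 0 = -2 := by
  decide

/-- [folklore] **THE COEFFICIENTS ARE PINNED**: if rational coefficients `(a, b)` satisfy `a·curvAdj (curv A) μ y + b·dz (codiff₁ A) μ y = codiff₁ (dz (A μ)) y` at the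
two witnesses (an2's `quadForm` and the inline exact form `A₀ = x₀²`, direction `0`, origin), then `(a, b) = (½, 1)` — the normalisation of X₁-SPEC §0 (`r = 2` in RULING ρ-g5-5's display) is the
only one compatible with an2's typed operators. -/
theorem witness_coefficients_unique (a b : ℚ)
    (h1 : a * (curvAdj (curv quadForm) 0 0 : ℤ) + b * (dz (codiff₁ quadForm) 0 0 : ℤ) = (codiff₁ (dz (quadForm 0)) 0 : ℤ))
    (h2 : a * (curvAdj (curv (fun κ x => if κ = 0 then x 0 ^ 2 else 0 : Form1 2 ℤ)) 0 0 : ℤ)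
        + b * (dz (codiff₁ (fun κ x => if κ = 0 then x 0 ^ 2 else 0 : Form1 2 ℤ)) 0 0 : ℤ)
        = (codiff₁ (dz ((fun κ x => if κ = 0 then x 0 ^ 2 else 0 : Form1 2 ℤ) 0)) 0 : ℤ)) :
    a = 1 / 2 ∧ b = 1 := by
  obtain ⟨e1, e2, e3⟩ := witness_quadForm
  obtain ⟨f1, f2, f3⟩ := witness_sqForm
  rw [e1, e2, e3] at h1
  rw [f1, f2, f3] at h2
  push_cast at h1 h2
  constructor <;> linarith

end Witness

end Summit.QuantumFields.BalabanUV.Beta.D1BFx.HodgeIdentityForms
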